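import Literature.NumberTheory.Transcendental.BoxIntegralZetaValues
import Literature.NumberTheory.Transcendental.KZMellinFibres
import Literature.NumberTheory.Transcendental.KZLogCalculusProofs

/-!
# `NormalFormPrinciple` (stmt-KontsevichZagierPeriods-3869), line `SketchIdeator1` —
# the level-one box tower: the representations `[(0,1)ʷ, P/(1 − x₀⋯x_{w−1})]` exist (`w ≥ 2`)

Pure proof file (stub `exists_levelOneRep_dim` of the level-one box tower, lead seat c7;
`--supports` the crux). For every dimension `w ≥ 2` and every numerator `P ∈ ℚ[x₀, …, x_{w−1}]`
the pair (open unit box of `ℝʷ`, `x ↦ P(x)/(1 − x₀⋯x_{w−1})`) is an integral representation in the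
sense of the tree's Kontsevich–Zagier calculus
(`Literature.NumberTheory.Transcendental.KZ.IntegralRep w`):

* the open box is `ℚ`-semialgebraic (`KZ.isSemialgebraic_box`);
* the integrand is a quotient of `ℚ`-polynomials whose denominator `1 − x₀⋯x_{w−1}` is positive on
  the box (`isSemialgebraicFunOn_aeval_div_aeval`, `BoxIntegral.prod_mem_Ioo`);
* absolute convergence: `P` is continuous, hence bounded on the compact cube `[0,1]ʷ`, and the
  kernel `1/(1 − x₀⋯x_{w−1})` is integrable on the open box as soon as `w ≥ 2`
  (`BoxIntegral.integrableOn_box_one_div_one_sub_prod`, the `ζ(w)` box integral), so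
  "bounded × integrable" (`MeasureTheory.IntegrableOn.continuousOn_mul_of_subset`) applies.

This is the dimension-`w` analogue of the landed dimension-two file
`HurwitzMicroSectorsNormalFormPrincipleLevelOneExistsRep` (same proof with `∏ i, x i` for `x 0 * x 1`).
Sources: M. Kontsevich, D. Zagier, *Periods* (2001), §1.1; F. Beukers, *A note on the
irrationality of ζ(2) and ζ(3)*, Bull. LMS 11 (1979). No definitions are introduced.
-/

noncomputable section

open MeasureTheory Set
open Literature.NumberTheory.Transcendental Literature.NumberTheory.Transcendental.KZ
open Literature.ModelTheory.ExponentialFields (IsSemialgebraic)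

namespace Summit.KontsevichZagierPeriods.HurwitzMicroSectors.NormalFormPrinciple.PiBox.LevelOne

/-- The kernel denominator `1 − x₀⋯x_{w−1}` is positive on the open unit box of `ℝʷ` (`w ≥ 1`).
[folklore] -/
theorem one_sub_prod_pos_of_mem_box_dim {w : ℕ} (hw : w ≠ 0) {x : Fin w → ℝ}
    (hx : ∀ i, x i ∈ Set.Ioo (0:ℝ) 1) : 0 < 1 - ∏ i, x i :=
  sub_pos.2 (BoxIntegral.prod_mem_Ioo hw hx).2

/-- The open unit box of `ℝʷ` lies in the closed unit cube `[0,1]ʷ`. [folklore] -/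
theorem box_subset_Icc_dim (w : ℕ) :
    {x : Fin w → ℝ | ∀ i, x i ∈ Set.Ioo (0:ℝ) 1} ⊆ Set.Icc 0 1 :=
  fun _ hx => ⟨fun i => (hx i).1.le, fun i => (hx i).2.le⟩

/-- **Semialgebraicity of the level-one integrand (dimension `w`).** For `P ∈ ℚ[x₀,…,x_{w−1}]`
(`w ≥ 1`), `x ↦ P(x)/(1 − x₀⋯x_{w−1})` is a `ℚ`-semialgebraic function on the open unit box (a
quotient of `ℚ`-polynomials with non-vanishing denominator). [Kontsevich–Zagier 2001, §1.1]
[folklore] -/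
theorem isSemialgebraicFunOn_aeval_div_one_sub_prod_dim {w : ℕ} (hw : w ≠ 0)
    (p : MvPolynomial (Fin w) ℚ) :
    IsSemialgebraicFunOn ℚ {x : Fin w → ℝ | ∀ i, x i ∈ Set.Ioo (0:ℝ) 1}
      (fun x => (MvPolynomial.aeval x p : ℝ) / (1 - ∏ i, x i)) := by
  refine (isSemialgebraicFunOn_aeval_div_aeval (isSemialgebraic_box w) p
    (1 - ∏ i, MvPolynomial.X i) fun x hx => ?_).congr fun x _ => by
      simp only [map_sub, map_one, map_prod, MvPolynomial.aeval_X]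
  simp only [map_sub, map_one, map_prod, MvPolynomial.aeval_X]
  exact (one_sub_prod_pos_of_mem_box_dim hw hx).ne'

/-- **Absolute convergence of the level-one integrand (dimension `w ≥ 2`).** For
`P ∈ ℚ[x₀,…,x_{w−1}]`, `P(x)/(1 − x₀⋯x_{w−1})` is integrable on the open unit box: `P` is bounded on
the compact cube `[0,1]ʷ` and `1/(1 − x₀⋯x_{w−1})` is integrable there (the box integral for
`ζ(w)`). [folklore] -/
theorem integrableOn_aeval_div_one_sub_prod_dim {w : ℕ} (hw : 2 ≤ w)
    (p : MvPolynomial (Fin w) ℚ) :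
    IntegrableOn (fun x : Fin w → ℝ => (MvPolynomial.aeval x p : ℝ) / (1 - ∏ i, x i))
      {x | ∀ i, x i ∈ Set.Ioo (0:ℝ) 1} := by
  have hA : MeasurableSet {x : Fin w → ℝ | ∀ i, x i ∈ Set.Ioo (0:ℝ) 1} :=
    Literature.ModelTheory.ExponentialFields.IsSemialgebraic.measurableSet_holds
      (isSemialgebraic_box w)
  have h := (BoxIntegral.integrableOn_box_one_div_one_sub_prod hw).continuousOn_mul_of_subset
    (Literature.ModelTheory.ExponentialFields.continuous_aeval_real p).continuousOn
    isCompact_Icc hA (box_subset_Icc_dim w)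
  simpa only [mul_one_div] using h

/-- **E1ʷ (existence of the level-one representation in dimension `w ≥ 2`).** For every
`P ∈ ℚ[x₀,…,x_{w−1}]` there is an integral representation of dimension `w` with domain the open
unit box `(0,1)ʷ` and integrand `x ↦ P(x)/(1 − x₀⋯x_{w−1})` (values in `ℚ + Σ_{2≤j≤w} ℚζ(j)`).
[Kontsevich–Zagier 2001, §1.1] [folklore] -/
theorem exists_levelOneRep_dim {w : ℕ} (hw : 2 ≤ w) (p : MvPolynomial (Fin w) ℚ) :
    ∃ N : IntegralRep w, N.domain = {x | ∀ i, x i ∈ Set.Ioo (0:ℝ) 1} ∧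
      N.integrand = fun x => (MvPolynomial.aeval x p : ℝ) / (1 - ∏ i, x i) :=
  ⟨⟨_, _, isSemialgebraic_box w,
    isSemialgebraicFunOn_aeval_div_one_sub_prod_dim (by omega) p,
    integrableOn_aeval_div_one_sub_prod_dim hw p⟩, rfl, rfl⟩

end Summit.KontsevichZagierPeriods.HurwitzMicroSectors.NormalFormPrinciple.PiBox.LevelOne
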